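import Literature.AnabelianGeometry.EtaleTheta.BiKummer

/-!
# [EtTh] §4, part 2: Propositions 4.2–4.3 (roots and bi-Kummer roots of fraction-pairs),
# Remarks 4.3.1–4.3.2, Theorem 4.4 (category-theoreticity of bi-Kummer data), Remark 4.4.1

Source: [MochizukiEtTh2009] §4, PDF pp. 88–96 (printed 314–322). Locators `p.N` = PDF page. Typed
over the hypothesis structure `BiKummerSetting` of `BiKummer.lean` (see there for the conventions):
the DATA notions ("`N`-th root of a fraction-pair", "bi-Kummer `N`-th root", the hypothesis of
Theorem 4.4) are structures; the existence/uniqueness/compatibility assertions are named `Prop`s, each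
quoting the printed statement and saying which clause it renders. The transport
`((α')^birat)^* : O^×(A^birat) → O^×(A_N^birat)` along a (pull-back) morphism ([FrdI] Prop 1.11 (iv))
is an explicit parameter `pullFrac` (TODO-merge(abc-iut-L1-t1)).

Versions (owner abc-iut-L2-t3): v2 (abc-iut-L6-t23, succession rule) repaired `striv`/`Prop43_i`/`Prop43_ii`/
`Thm44_iv` (R-9, L6-t23/L6-t12); v3/v4 (owner's self-audit): pin `BiKummerRoot.autBase_ident`, `Prop43_i` for
domains `≅ A_⊙`, `Thm44Hyp` p.93 qualifiers, `Thm44_iv` binds the root-diagram identification; v5 (referee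
D7-F1/F2/F4): `Thm44_iii` under print's ampleness/fixedness hypotheses, `Thm44_i` rider, two base fields.
-/

noncomputable section

namespace Literature.AnabelianGeometry.EtaleTheta

open CategoryTheory Opposite Literature.AlgebraicGeometry.Frobenioids

universe u₀ v₀ u v w

variable {K : Type u₀} [Field K]

namespace BiKummerSetting

variable {X : SemiGraphs.TemperedArithmeticGroup.{u₀} K} {D₀ : Type u₀} [Category.{v₀} D₀] {V : FrdIMonoidStub.{w}}
  {T : RealifiedDivisorMonoids (D₀ := D₀) V} {D : Type u} [Category.{v} D]
  {VD : FrdICatStub.{u, v, w} D} (S : BiKummerSetting X T D VD)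

/-! ## Proposition 4.2 (pp.88–89): roots of fraction-pairs -/

/-- **Proposition 4.2 (i)** (p.88): "A pair of morphisms `t', t'' : A → C` is a right fraction-pair for
`f` if and only if there exists a [necessarily unique] isomorphism `v : B ≅ C` such that `t' = v ∘ s'`,
`t'' = v ∘ s''`" (for a given right fraction-pair `(s', s'')` for `f`). Named `Prop`.
[cite: MochizukiEtTh2009, Prop 4.2 p.88] -/
def Prop42_i : Prop :=
  ∀ {A B C : S.C} (f : S.biratUnits A) (P : S.FractionPair f B) (t' t'' : A ⟶ C),
    (∃ Q : S.FractionPair f C, Q.num = t' ∧ Q.den = t'') ↔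
      ∃! v : B ≅ C, P.num ≫ v.hom = t' ∧ P.den ≫ v.hom = t''

/-- **Proposition 4.2 (ii)** (p.88): "A pair of morphisms `t', t'' : C → B` is a left fraction-pair for
`f|_B` if and only if there exists a [necessarily unique] isomorphism `v : C ≅ A` such that
`t' = s' ∘ v`, `t'' = s'' ∘ v`." Named `Prop`. [cite: MochizukiEtTh2009, Prop 4.2 p.88] -/
def Prop42_ii : Prop :=
  ∀ {A B C : S.C} (f : S.biratUnits A) (P : S.FractionPair f B) (g : S.biratUnits C)
    (Q : S.FractionPair g B), Q.restrict = P.restrict →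
      ∃! v : C ≅ A, v.hom ≫ P.num = Q.num ∧ v.hom ≫ P.den = Q.den

/-- **Proposition 4.2 (iii)** (p.88), the DATA of "an *`N`-th root of the fraction-pair* `(s', s'')`":
"commutative diagrams `A_N —s'_N→ B_N`, `A_N —s''_N→ B_N` over `A —s'→ B`, `A —s''→ B` via
`α : A_N → A`, `β : B_N → B` — where `α, β` are isometries of Frobenius degree `N`; `α` is of
base-Frobenius type, with factorization of base-Frobenius type `α = α' ∘ α''`; `f|_{A_N} := ((α')^birat)^*(f)`;
`A_N` is `(N, H_⊙, f|_{A_N})`-saturated; `s'_N, s''_N : A_N → B_N` are base-equivalent pre-steps" and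
"(s'_N, s''_N) is a right … fraction-pair [for an element] whose `N`-th power is equal to `f|_{A_N}`".
`A_N` is the *`N`-domain*, `B_N` the *`N`-codomain*. (`pullFrac` renders `((α')^birat)^*`; in print
the domain is `A = A_⊙`, p.88 — Props 4.2 (iii), (iv) are stated for that case below, (i), (ii) being
formal for any domain.)
ERRATUM E2: the printed existence proof (p.89) uses condition (a) of [IUTchI] Rmk 3.2.4 (i).
[cite: MochizukiEtTh2009, Prop 4.2 p.88] -/
structure NthRoot {A B : S.C} (f : S.biratUnits A) (P : S.FractionPair f B) (N : ℕ+)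
    (pullFrac : ∀ {A' : S.C} (_ : A' ⟶ A), S.biratUnits A → S.biratUnits A') where
  /-- the `N`-domain `A_N` -/
  AN : S.C
  /-- the `N`-codomain `B_N` -/
  BN : S.C
  /-- `α : A_N → A` -/
  α : AN ⟶ A
  /-- `β : B_N → B` -/
  β : BN ⟶ B
  /-- the `N`-th root `f_N ∈ O^×(A_N^birat)` with `f_N^N = f|_{A_N}` -/
  root : S.biratUnits AN
  /-- the fraction-pair `(s'_N, s''_N)` for the root -/
  pair : S.FractionPair root BN
  /-- commutativity `s' ∘ α = β ∘ s'_N` -/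
  comm_num : pair.num ≫ β = α ≫ P.num
  /-- commutativity `s'' ∘ α = β ∘ s''_N` -/
  comm_den : pair.den ≫ β = α ≫ P.den
  /-- `α, β` are isometries of Frobenius degree `N` -/
  isIsometry : S.IsIsometry α ∧ S.IsIsometry β ∧ S.degFr α = N ∧ S.degFr β = N
  /-- `α` is of base-Frobenius type, with chosen factorization -/
  αData : S.BaseFrobeniusTypeData α
  /-- `f_N^N = f|_{A_N} := ((α')^birat)^*(f)` -/
  pow_root : root ^ (N : ℕ) = pullFrac αData.α₁ f
  /-- `A_N` is `(N, H_⊙, f|_{A_N})`-saturated -/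
  isSaturated : S.IsSaturated AN N (pullFrac αData.α₁ f)

/-- **Proposition 4.2 (iii)** (p.88), the existence assertion: "There exist commutative diagrams …",
i.e. every fraction-pair admits an `N`-th root. Named `Prop`. [cite: MochizukiEtTh2009, Prop 4.2 p.88] -/
def Prop42_iii (pullFrac : ∀ {A A' : S.C} (_ : A' ⟶ A), S.biratUnits A → S.biratUnits A') : Prop :=
  ∀ {B : S.C} (f : S.biratUnits S.Aodot) (P : S.FractionPair f B) (N : ℕ+),
    Nonempty (S.NthRoot f P N pullFrac)

/-- **Proposition 4.2 (iv)** (pp.88–89), "an *isomorphism between the two given `N`-th roots* of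
fraction-pairs": for two `N`-th roots (the second of a left fraction-pair `(s'δ, s''δ)` for `f|_B`,
`δ ∈ Aut_C(A)`), "after possibly replacing `s''_N` by `u ∘ s''_N`, for some `u ∈ μ_N(B_N)`, there exist
isomorphisms `ζ_A : A_N ≅ A_N'`, `ζ_B : B_N ≅ B_N'` in `C` which fit into commutative diagrams [with
`s'_N`, `s''_N`] and, moreover, satisfy `α = δ ∘ α' ∘ ζ_A`, `β = β' ∘ ζ_B`, `ζ_A^bs = A'`. Here, `ζ_B`
is uniquely determined by `ζ_A`; `ζ_A` is uniquely determined by `A'`, up to composition with an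
element of `μ_N(A_N)`." Rendered for `δ = id` (the text reduces to this case, p.90) and a prescribed
base isomorphism `A'`. Named `Prop`. [cite: MochizukiEtTh2009, Prop 4.2 p.89] -/
def Prop42_iv (pullFrac : ∀ {A A' : S.C} (_ : A' ⟶ A), S.biratUnits A → S.biratUnits A') : Prop :=
  ∀ {B : S.C} (f : S.biratUnits S.Aodot) (P : S.FractionPair f B) (N : ℕ+)
    (R R' : S.NthRoot f P N pullFrac) (ebs : S.base.obj R.AN ≅ S.base.obj R'.AN),
    S.base.map R.α = ebs.hom ≫ S.base.map R'.α →
      ∃ (u : S.mu R.BN N) (ζA : R.AN ≅ R'.AN) (ζB : R.BN ≅ R'.BN),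
        ζA.hom ≫ R'.pair.num = R.pair.num ≫ ζB.hom ∧
        ζA.hom ≫ R'.pair.den = (R.pair.den ≫ (u : Aut R.BN).hom) ≫ ζB.hom ∧
        ζA.hom ≫ R'.α = R.α ∧ ζB.hom ≫ R'.β = R.β ∧ S.base.mapIso ζA = ebs

/-! ## Proposition 4.3 (pp.90–91): bi-Kummer roots -/

/-- **Proposition 4.3 (i)** (pp.90–91), the DATA of "a *bi-Kummer `N`-th root* `(s'_N{}^{gp}, s''_N{}^{gp})`
of the fraction-pair": given "`s_N^triv : H_{A_N} → Aut_C(A_N)` … the group homomorphism arising from a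
base-Frobenius pair of `A_N`", "unique group homomorphisms `s'_N{}^{gp}, s''_N{}^{gp} : H_{B_N} → Aut_C(B_N)`
such that, relative to the isomorphism `H_{A_N} ≅ H_{B_N}` determined by the [base-equivalent!] pair of
morphisms `s'_N, s''_N`, we have `s'_N{}^{gp}(h) ∘ s'_N = s'_N ∘ (s_N^triv|_{H_{B_N}})(h)`;
`s''_N{}^{gp}(h) ∘ s''_N = s''_N ∘ (s_N^triv|_{H_{B_N}})(h)` for all `h ∈ H_{B_N}`." The identification
`H_{A_N} ≅ H_{B_N}` is carried as the datum `ident`, pinned over the base by `autBase_ident` (v4).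
[cite: MochizukiEtTh2009, Prop 4.3 p.90] -/
structure BiKummerRoot {A B : S.C} {f : S.biratUnits A} {P : S.FractionPair f B} {N : ℕ+}
    {pullFrac : ∀ {A A' : S.C} (_ : A' ⟶ A), S.biratUnits A → S.biratUnits A'}
    (R : S.NthRoot f P N pullFrac) (hA : S.IsGalois R.AN) (hB : S.IsGalois R.BN) where
  /-- `s_N^triv : H_{A_N} → Aut_C(A_N)`, from a base-Frobenius pair of `A_N` -/
  striv : S.HA R.AN hA →* Aut R.AN
  /-- `s_N^triv` is a SECTION over `H_{A_N}`: "the group homomorphism arising from a base-Frobenius pair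
  of `A_N` [cf. Theorem 3.7, (i); [FrdI], Proposition 5.6]" (p.90) lifts each `h` to an automorphism
  with the SAME base automorphism (v2, R-9 finding F1 of abc-iut-L6-t12 22:05:46Z: v1 left `striv` an
  arbitrary homomorphism, under which `Prop43_iii` is not the printed statement — the printed argument
  "`f|_{A_N}` is `H_{A_N}`-fixed" needs the section property — and the trivial datum `striv = 1,
  s' = s'' = 1` was a bi-Kummer root) -/
  autBase_striv : ∀ h : S.HA R.AN hA, S.autBase R.AN (striv h) = S.autBase R.AN (h : Aut R.AN)
  /-- the isomorphism `H_{A_N} ≅ H_{B_N}` determined by the base-equivalent pair `s'_N, s''_N` -/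
  ident : S.HA R.AN hA ≃* S.HA R.BN hB
  /-- `ident` LIES OVER the base-isomorphism of the pair: `Base(s'_N) ∘ Base(ident h) = Base(h) ∘ Base(s'_N)`
  — print's identification "determined by the [base-equivalent!] pair of morphisms `s'_N, s''_N`" (p.90) is
  conjugation by `(s'_N)^bs = (s''_N)^bs` on `H_A ⊆ Aut_C(A)/O^×(A) ↪ Aut_D(A^bs)` (Def 4.1 (ii) p.87).
  (v4: additive PIN, abc-iut-L6-t23's root-cause suggestion 22:49:05Z on the owner's R-9 self-audit: with
  `ident` entirely free, the twist of a bi-Kummer root by an inner automorphism of `H_{A_N}` was again a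
  bi-Kummer root, cf. `Thm44_iv`; the pin leaves exactly print's `O^×`-ambiguity.) -/
  autBase_ident : ∀ h : S.HA R.AN hA,
    S.base.map R.pair.num ≫ S.base.map (ident h : Aut R.BN).hom =
      S.base.map (h : Aut R.AN).hom ≫ S.base.map R.pair.num
  /-- `s'_N{}^{gp} : H_{B_N} → Aut_C(B_N)` -/
  sNum : S.HA R.BN hB →* Aut R.BN
  /-- `s''_N{}^{gp} : H_{B_N} → Aut_C(B_N)` -/
  sDen : S.HA R.BN hB →* Aut R.BN
  /-- `s'_N{}^{gp}(h) ∘ s'_N = s'_N ∘ s_N^triv(h)` -/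
  comm_num : ∀ h : S.HA R.AN hA, R.pair.num ≫ (sNum (ident h)).hom = (striv h).hom ≫ R.pair.num
  /-- `s''_N{}^{gp}(h) ∘ s''_N = s''_N ∘ s_N^triv(h)` -/
  comm_den : ∀ h : S.HA R.AN hA, R.pair.den ≫ (sDen (ident h)).hom = (striv h).hom ≫ R.pair.den

/-- `s_N^triv(h) ∈ H_{A_N}`: a trivializing section lands in `H_{A_N} ⊆ Aut_C(A_N)` (the inverse image of
`H_{A_N^bs}`), by `autBase_striv`. [cite: MochizukiEtTh2009, Prop 4.3 p.90] -/
theorem BiKummerRoot.striv_mem {A B : S.C} {f : S.biratUnits A} {P : S.FractionPair f B} {N : ℕ+}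
    {pullFrac : ∀ {A A' : S.C} (_ : A' ⟶ A), S.biratUnits A → S.biratUnits A'}
    {R : S.NthRoot f P N pullFrac} {hA : S.IsGalois R.AN} {hB : S.IsGalois R.BN}
    (K : S.BiKummerRoot R hA hB) (h : S.HA R.AN hA) : K.striv h ∈ S.HA R.AN hA := by
  have h2 : S.autBase R.AN (h : Aut R.AN) ∈ S.HAbs R.AN hA := h.2
  show S.autBase R.AN (K.striv h) ∈ S.HAbs R.AN hA
  rw [K.autBase_striv h]
  exact h2

/-- **Proposition 4.3 (i)** (p.90), existence and uniqueness: for every trivializing SECTION `s_N^triv`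
(v2: hypothesis `hstriv`, matching the field `autBase_striv`) and every identification `ident` lying over
the base (v4: `hident`, matching the field `autBase_ident`) there is exactly one pair
`(s'_N{}^{gp}, s''_N{}^{gp})`; "[In particular, it follows that `B_N` is `H_⊙`-ample.]"  Stated, as print
("In the notation of Proposition 4.2, (iii)"), for fraction-pairs with domain `≅ A_⊙` (v4, note G1 of
abc-iut-L6-t12 22:55:34Z: the printed existence argument uses that `H_⊙` acts trivially on `A_⊙^bs`).
Named `Prop`. [cite: MochizukiEtTh2009, Prop 4.3 p.90] -/
def Prop43_i (pullFrac : ∀ {A A' : S.C} (_ : A' ⟶ A), S.biratUnits A → S.biratUnits A') : Prop :=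
  ∀ {A B : S.C} {f : S.biratUnits A} {P : S.FractionPair f B} {N : ℕ+}
    (R : S.NthRoot f P N pullFrac) (hA : S.IsGalois R.AN) (hB : S.IsGalois R.BN)
    (striv : S.HA R.AN hA →* Aut R.AN)
    (_hstriv : ∀ h : S.HA R.AN hA, S.autBase R.AN (striv h) = S.autBase R.AN (h : Aut R.AN))
    (ident : S.HA R.AN hA ≃* S.HA R.BN hB)
    (_hident : ∀ h : S.HA R.AN hA,
      S.base.map R.pair.num ≫ S.base.map (ident h : Aut R.BN).hom =
        S.base.map (h : Aut R.AN).hom ≫ S.base.map R.pair.num),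
    Nonempty (A ≅ S.Aodot) →
    (∃! p : (S.HA R.BN hB →* Aut R.BN) × (S.HA R.BN hB →* Aut R.BN),
      ∃ K : S.BiKummerRoot R hA hB, K.striv = striv ∧ K.ident = ident ∧ K.sNum = p.1 ∧ K.sDen = p.2)
    ∧ S.IsAmple R.BN

/-- **Proposition 4.3 (ii)** (p.91): "the collection of bi-Kummer `N`-th roots, with `N`-codomain `B_N`, of
a fraction-pair with domain isomorphic to `A_⊙` … is equal to the collection of pairs obtained from
`(s'_N{}^{gp}, s''_N{}^{gp})` by (a) simultaneous conjugation by an element `ζ_Aut ∈ O^×(B_N)`, followed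
by (b) non-simultaneous conjugation [of, say, `s''_N{}^{gp}`, but not `s'_N{}^{gp}`] by an element
`u ∈ μ_N(B_N)`". Rendered as: any two bi-Kummer roots on the same `N`-th root, with the same
identification `H_{A_N} ≅ H_{B_N}` and with trivializing sections `s_N^triv` that differ by
`O^×(A_N)`-conjugation (base-Frobenius pairs are determined up to `O^×(A_N)`-conjugation, [FrdI]
Prop. 5.6; Rmk. 4.3.1) differ by (a)+(b).  (v2: the two hypotheses `hident`, `hstriv` added with
`autBase_striv` — R-9 finding F1 of abc-iut-L6-t12: v1 compared ARBITRARY pairs `K, K'`, which is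
refutable and forces `s' = s'' = 1`.)  Named `Prop`. [cite: MochizukiEtTh2009, Prop 4.3 p.91] -/
def Prop43_ii (pullFrac : ∀ {A A' : S.C} (_ : A' ⟶ A), S.biratUnits A → S.biratUnits A') : Prop :=
  ∀ {A B : S.C} {f : S.biratUnits A} {P : S.FractionPair f B} {N : ℕ+}
    (R : S.NthRoot f P N pullFrac) (hA : S.IsGalois R.AN) (hB : S.IsGalois R.BN)
    (K K' : S.BiKummerRoot R hA hB) (_hident : K'.ident = K.ident)
    (_hstriv : ∃ ζA : S.units R.AN, ∀ h, K'.striv h = (ζA : Aut R.AN) * K.striv h * (ζA : Aut R.AN)⁻¹),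
    Nonempty (A ≅ S.Aodot) →
      ∃ (ζ : S.units R.BN) (u : S.mu R.BN N), ∀ h,
        K'.sNum h = (ζ : Aut R.BN) * K.sNum h * (ζ : Aut R.BN)⁻¹ ∧
        K'.sDen h = ((u : Aut R.BN) * (ζ : Aut R.BN)) * K.sDen h * ((u : Aut R.BN) * (ζ : Aut R.BN))⁻¹

/-- **Proposition 4.3 (iii)** (p.91): "the difference `s'_N{}^{gp} · (s''_N{}^{gp})⁻¹` determines a twisted
homomorphism `H_{B_N} → μ_N(B_N)`, hence an element of the cohomology module `H¹(H_{B_N}, μ_N(B_N))`,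
which is equal to the Kummer class [cf. [FrdII], Definition 2.1, (ii)] `κ_{f|_{B_N}}` …. In particular,
this cohomology class is independent of the … conjugation operations discussed in (ii)." Rendered by
its first clause: the values of `h ↦ s'(h) s''(h)⁻¹` lie in `μ_N(B_N)` (the comparison with the [FrdII]
Kummer class is TODO-merge(abc-iut-L1-t4)). Named `Prop`. [cite: MochizukiEtTh2009, Prop 4.3 p.91] -/
def Prop43_iii (pullFrac : ∀ {A A' : S.C} (_ : A' ⟶ A), S.biratUnits A → S.biratUnits A') : Prop :=
  ∀ {A B : S.C} {f : S.biratUnits A} {P : S.FractionPair f B} {N : ℕ+}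
    (R : S.NthRoot f P N pullFrac) (hA : S.IsGalois R.AN) (hB : S.IsGalois R.BN)
    (K : S.BiKummerRoot R hA hB) (h : S.HA R.BN hB), K.sNum h * (K.sDen h)⁻¹ ∈ S.mu R.BN N

/-! ### Remarks 4.3.1, 4.3.2 (pp.92–93) — documentation
4.3.1: "even without … base-Frobenius pairs …, liftings to `Aut_C(A_N)` of individual elements of
`H_{A_N}` … are completely determined up to possible translation by elements of `O^×(A_N)`. The crucial
difference … [is that conjugation] allows one to work with sections … which are group homomorphisms."
4.3.2: for `N ∣ N'` there is a "morphism" from a suitable `N'`-th root to a given `N`-th root (isometries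
`α_{N,N'}`, `β_{N,N'}` of Frobenius degree `N'/N`), inducing `H¹(H_{B_N}, μ_N(B_N)) → H¹(H_{B_{N'}}, μ_N(B_{N'}))`
compatible with Kummer classes; "by allowing `N` to vary, we obtain a compatible system of roots … hence
a compatible system of Kummer classes, which, by Proposition 3.2, (iii), is sufficient to distinguish `f`".
The compatible systems are the `RootSystem`/`kummerClass` formalism of `Cyclotome.lean`/`KummerClass.lean`. -/

/-! ## Theorem 4.4 (pp.93–95): category-theoreticity of bi-Kummer data -/

section Theorem44

variable {K' : Type u₀} [Field K'] {X₁ : SemiGraphs.TemperedArithmeticGroup.{u₀} K}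
  {X₂ : SemiGraphs.TemperedArithmeticGroup.{u₀} K'} {D₀' : Type u₀} [Category.{v₀} D₀']
  {T₁ : RealifiedDivisorMonoids (D₀ := D₀) V} {T₂ : RealifiedDivisorMonoids (D₀ := D₀') V}
  {D₁ D₂ : Type u} [Category.{v} D₁] [Category.{v} D₂] {VD₁ : FrdICatStub.{u, v, w} D₁}
  {VD₂ : FrdICatStub.{u, v, w} D₂} (S₁ : BiKummerSetting X₁ T₁ D₁ VD₁) (S₂ : BiKummerSetting X₂ T₂ D₂ VD₂)

/-- The hypothesis of **Theorem 4.4** (p.93; "for `i = 1, 2`, let `p_i` be a prime number; `K_i` a finite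
extension of `ℚ_{p_i}`" — the two settings live over possibly different fields `K`, `K'`, v5):
"an equivalence of categories `Ψ : C₁ ≅ C₂` which induces
… an equivalence `Ψ^bs : D₁ ≅ D₂` that maps `A_{⊙,1}^bs` to an isomorph of `A_{⊙,2}^bs`", the two settings
having monoid type `ℤ` and perfect divisor monoids (fields of `BiKummerSetting`) and moreover (v4, the two
printed qualifiers of p.93 not carried by the setting, referee D5-F9): "whose divisor monoid `Φ_i` is …
non-dilating, and whose base category `D_i` is of the form `D_i := B^temp(X_i^log)[𝒟_i]`" — rendered as:
`Base : D_i ⥤ D₀` is fully faithful with essential image the objects admitting an arrow to some `𝒟_i`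
(§0, `C[A]`) — and "`A_{⊙,i}^bs` … Galois, hence determines a normal open subgroup `H_{⊙,i} ⊆ Π^tp_{X_i}`"
(normality is automatic for the kernel `Hodot`; openness is the field). [cite: MochizukiEtTh2009, Thm 4.4 p.93] -/
structure Thm44Hyp where
  /-- "whose divisor monoid `Φ₁` is … non-dilating" ([FrdI] Def 1.1 (i)) -/
  isNonDilating₁ : ∀ (A : D₁ᵒᵖ) (φ : A ⟶ A), V.IsNonDilating (S₁.tf.Φ.carrier A) (S₁.tf.Φ.pull φ)
  /-- "whose divisor monoid `Φ₂` is … non-dilating" -/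
  isNonDilating₂ : ∀ (A : D₂ᵒᵖ) (φ : A ⟶ A), V.IsNonDilating (S₂.tf.Φ.carrier A) (S₂.tf.Φ.pull φ)
  /-- "`D₁ := B^temp(X₁^log)[𝒟₁]`": `Base : D₁ → D₀` is the inclusion of the full subcategory `D₀[𝒟₁]` -/
  baseShape₁ : S₁.tf.base.Full ∧ S₁.tf.base.Faithful ∧
    ∃ 𝒟 : D₀, ∀ Y : D₀, (∃ A : D₁, Nonempty (S₁.tf.base.obj A ≅ Y)) ↔ Nonempty (Y ⟶ 𝒟)
  /-- "`D₂ := B^temp(X₂^log)[𝒟₂]`" -/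
  baseShape₂ : S₂.tf.base.Full ∧ S₂.tf.base.Faithful ∧
    ∃ 𝒟 : D₀', ∀ Y : D₀', (∃ A : D₂, Nonempty (S₂.tf.base.obj A ≅ Y)) ↔ Nonempty (Y ⟶ 𝒟)
  /-- "`H_{⊙,1} ⊆ Π^tp_{X₁}` … open" -/
  isOpen_Hodot₁ : IsOpen (S₁.Hodot : Set X₁.Pi)
  /-- "`H_{⊙,2} ⊆ Π^tp_{X₂}` … open" -/
  isOpen_Hodot₂ : IsOpen (S₂.Hodot : Set X₂.Pi)
  /-- `Ψ : C₁ ≅ C₂` -/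
  Ψ : S₁.C ≌ S₂.C
  /-- `Ψ^bs : D₁ ≅ D₂` -/
  Ψbs : D₁ ≌ D₂
  /-- `Ψ^bs` is induced by `Ψ`: `Base ∘ Ψ ≅ Ψ^bs ∘ Base` -/
  comm : S₁.base ⋙ Ψbs.functor ≅ Ψ.functor ⋙ S₂.base
  /-- `Ψ^bs(A_{⊙,1}^bs)` is an isomorph of `A_{⊙,2}^bs` -/
  mapsAodot : IsIsomorph (Ψbs.functor.obj (S₁.base.obj S₁.Aodot)) (S₂.base.obj S₂.Aodot)

variable {S₁ S₂}

/-- "the isomorphisms … `Aut_{C₁}(B₁) ≅ Aut_{C₂}(B₂)`" induced by `Ψ` and an identification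
`e : Ψ(B₁) ≅ B₂` (Thm 4.4 (iv), p.94): `σ ↦ e⁻¹ ∘ Ψ(σ) ∘ e`, as a group homomorphism (v3).
[cite: MochizukiEtTh2009, Thm 4.4 p.94] -/
def Thm44Hyp.transportAut (h : Thm44Hyp S₁ S₂) {Y : S₁.C} {Z : S₂.C} (e : h.Ψ.functor.obj Y ≅ Z) :
    Aut Y →* Aut Z :=
  (Aut.autMulEquivOfIso e).toMonoidHom.comp (h.Ψ.functor.mapAut Y)

/-- `transportAut e σ = e⁻¹ ≪≫ Ψ(σ) ≪≫ e`. [cite: MochizukiEtTh2009, Thm 4.4 p.94] -/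
theorem Thm44Hyp.transportAut_apply (h : Thm44Hyp S₁ S₂) {Y : S₁.C} {Z : S₂.C}
    (e : h.Ψ.functor.obj Y ≅ Z) (σ : Aut Y) :
    h.transportAut e σ = e.symm ≪≫ h.Ψ.functor.mapIso σ ≪≫ e := Aut.ext rfl

/-- `(transportAut e σ).hom = e⁻¹ ≫ Ψ(σ.hom) ≫ e`. [cite: MochizukiEtTh2009, Thm 4.4 p.94] -/
theorem Thm44Hyp.transportAut_hom (h : Thm44Hyp S₁ S₂) {Y : S₁.C} {Z : S₂.C}
    (e : h.Ψ.functor.obj Y ≅ Z) (σ : Aut Y) :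
    (h.transportAut e σ).hom = e.inv ≫ h.Ψ.functor.map σ.hom ≫ e.hom := rfl

/-- **Theorem 4.4 (i)** (p.94): "`Ψ` maps isomorphs of `A_{⊙,1}` to isomorphs of `A_{⊙,2}` and
`H_{⊙,1}`-ample objects to `H_{⊙,2}`-ample objects; `Ψ^bs` induces an isomorphism `H_{⊙,1} ≅ H_{⊙,2}`,
which is well-defined up to composition with inner automorphisms of `Π^tp_{X_i}`." Named `Prop`.  The
third clause is RENDERED BY `Nonempty (S₁.Hodot ≃* S₂.Hodot)` — an abstract isomorphism of groups: that it
is "induced by `Ψ^bs`" (through `Π^tp_{X_i} ↠ Aut_{D_i}(A_{⊙,i}^bs)`) and "well-defined up to inner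
automorphisms" is not expressible over `BiKummerSetting`, whose `galoisSurj` carries no naturality in the
Galois object (abc-iut-L6-t12's N1/N2); weaker than print on this axis, disclosed (referee D7-F2).
[cite: MochizukiEtTh2009, Thm 4.4 p.94] -/
def Thm44_i (h : Thm44Hyp S₁ S₂) : Prop :=
  (∀ A : S₁.C, IsIsomorph A S₁.Aodot → IsIsomorph (h.Ψ.functor.obj A) S₂.Aodot) ∧
  (∀ A : S₁.C, S₁.IsAmple A → S₂.IsAmple (h.Ψ.functor.obj A)) ∧
  Nonempty (S₁.Hodot ≃* S₂.Hodot)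

/-- **Theorem 4.4 (ii)** (p.94): "`Ψ` induces a 1-compatible equivalence of categories
`Ψ^birat : C₁^birat ≅ C₂^birat`. Moreover, `Ψ` preserves fraction-pairs, right fraction-pairs, and left
fraction-pairs. Finally, `Ψ` maps `N`-th roots of fraction-pairs with domain isomorphic to `A_{⊙,1}` to
`N`-th roots of fraction-pairs with domain isomorphic to `A_{⊙,2}`." Rendered by the fraction-pair
clause, through an identification `O^×(A^birat) ≅ O^×(Ψ(A)^birat)` supplied by `Ψ^birat` (datum `ψ`).
Named `Prop`. [cite: MochizukiEtTh2009, Thm 4.4 p.94] -/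
def Thm44_ii (h : Thm44Hyp S₁ S₂)
    (ψ : ∀ A : S₁.C, S₁.biratUnits A ≃* S₂.biratUnits (h.Ψ.functor.obj A)) : Prop :=
  ∀ {A B : S₁.C} (f : S₁.biratUnits A) (P : S₁.FractionPair f B),
    ∃ Q : S₂.FractionPair (ψ A f) (h.Ψ.functor.obj B),
      Q.num = h.Ψ.functor.map P.num ∧ Q.den = h.Ψ.functor.map P.den

/-- **Theorem 4.4 (iii)** (p.94): for `H_{⊙,i}`-ample `A_i`, `f_i ∈ O^×(A_i^birat)` fixed by `H_{A_i}`,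
`A₁ ↦ A₂` via `Ψ`, `f₁ ↦ f₂` via `Ψ^birat`: "`A₁` is `(N, H_{⊙,1}, f₁)`-saturated if and only if `A₂` is
`(N, H_{⊙,2}, f₂)`-saturated", and then "the isomorphism `H¹(H_{A₁}, μ_N(A₁)) ≅ H¹(H_{A₂}, μ_N(A₂))`
maps `κ_{f₁} ↦ κ_{f₂}`". Rendered by the saturation clause (the Kummer-class clause is
TODO-merge(abc-iut-L1-t4)), UNDER print's standing hypotheses on both sides — `A_i` `H_{⊙,i}`-ample and
`f_i` fixed by `H_{A_i}` (v5, referee D7-F1: v1–v4 stated the bare `↔`, which also transported ampleness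
and fixedness and so was stronger than print's warrant). Named `Prop`. [cite: MochizukiEtTh2009, Thm 4.4 p.94] -/
def Thm44_iii (h : Thm44Hyp S₁ S₂)
    (ψ : ∀ A : S₁.C, S₁.biratUnits A ≃* S₂.biratUnits (h.Ψ.functor.obj A)) : Prop :=
  ∀ (A : S₁.C) (N : ℕ+) (f : S₁.biratUnits A)
    (hA₁ : S₁.IsAmple A) (_hf₁ : S₁.IsFixedByHA A hA₁.isGalois f)
    (hA₂ : S₂.IsAmple (h.Ψ.functor.obj A)) (_hf₂ : S₂.IsFixedByHA (h.Ψ.functor.obj A) hA₂.isGalois (ψ A f)),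
    S₁.IsSaturated A N f ↔ S₂.IsSaturated (h.Ψ.functor.obj A) N (ψ A f)

/-- **Theorem 4.4 (iv)** (p.94): for `N`-codomains `B_i` of `N`-th roots of fraction-pairs with domain
isomorphic to `A_{⊙,i}` and their bi-Kummer `N`-th roots, `B₁ ↦ B₂`, `f₁ ↦ f₂`: "up to the [simultaneous
and non-simultaneous] conjugation operations discussed in Proposition 4.3, (ii), the isomorphisms
`H_{B₁} ≅ H_{B₂}`; `Aut_{C₁}(B₁) ≅ Aut_{C₂}(B₂)` map `s'₁{}^{gp} ↦ s'₂{}^{gp}`, `s''₁{}^{gp} ↦ s''₂{}^{gp}`,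
i.e., `Ψ` is compatible with bi-Kummer `N`-th roots." Named `Prop`.  BINDERS (each a printed hypothesis):
"`f₁ ↦ f₂` via `Ψ^birat`" (`eA`, `hf`; v2, R-9 of abc-iut-L6-t23); "`B₁ ↦ B₂` via `Ψ`" AS `N`-CODOMAINS OF
`N`-TH ROOTS, i.e. an identification of the root diagrams (`eAN`, `eB`, `hnum`, `hden` — the latter up to
`u₀ ∈ μ_N(B₂)`, Prop 4.2 (iv)); "THE isomorphisms `H_{B₁} ≅ H_{B₂}`, `Aut_{C₁}(B₁) ≅ Aut_{C₂}(B₂)`" induced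
by `Ψ` (`η`/`hη`, `ηA`/`hηA`, `transportAut`); and that `K₂` is THE bi-Kummer root corresponding to `K₁`
(`hident`; `hstriv`: trivializing sections agree up to `O^×(A₂,N)`-conjugation, [FrdI] Prop 5.6) —
v3/v4, owner's R-9 self-audit: with `ident`/`s^triv` carried as DATA (print's are canonical: `H_A ⊆
Aut_C(A)/O^×(A)`, Def 4.1 (ii) p.87) the v2 statement was still refutable, an inner-automorphism
reparametrisation of a bi-Kummer root being again one, which at `Ψ = id` forced `Base(H_{A_N})` to be
commutative (kernel form of the obstruction: `BiKummerRoot.autBase_comm_of_conj_reparam` in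
`Discharge/Sec4Thm44.lean`; derivation from the verbatim v2 text: cell staging
`HOME/staging/L2/L2-t3/Thm44Scratch.lean`).  So typed, (iv) is WEAKER than print and says so: in print these
correspondences are automatic (canonical `ident`; `Ψ` preserves base-Frobenius pairs and `N`-th roots, (ii)
and [FrdI] Thm 3.4 (v)), and (iv) follows from Prop 4.3 (ii) exactly as here
(`Discharge/Sec4Thm44.lean`, `thm44_iv_of_prop43_ii`).  The non-simultaneous conjugation (b) is put on the
`s''`-side, as print's hedge "[of, say, `s''_N{}^{gp}`, but not `s'_N{}^{gp}`]" (Prop 4.3 (ii)) allows.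
[cite: MochizukiEtTh2009, Thm 4.4 p.94] -/
def Thm44_iv (h : Thm44Hyp S₁ S₂)
    (ψ : ∀ A : S₁.C, S₁.biratUnits A ≃* S₂.biratUnits (h.Ψ.functor.obj A))
    (pullFrac₁ : ∀ {A A' : S₁.C} (_ : A' ⟶ A), S₁.biratUnits A → S₁.biratUnits A')
    (pullFrac₂ : ∀ {A A' : S₂.C} (_ : A' ⟶ A), S₂.biratUnits A → S₂.biratUnits A') : Prop :=
  ∀ {A₁ B₁ : S₁.C} {f₁ : S₁.biratUnits A₁} {P₁ : S₁.FractionPair f₁ B₁} {N : ℕ+}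
    (R₁ : S₁.NthRoot f₁ P₁ N pullFrac₁) (hA₁ : S₁.IsGalois R₁.AN) (hB₁ : S₁.IsGalois R₁.BN)
    (K₁ : S₁.BiKummerRoot R₁ hA₁ hB₁)
    {A₂ B₂ : S₂.C} (eA : h.Ψ.functor.obj A₁ ≅ A₂) {f₂ : S₂.biratUnits A₂}
    (_hf : f₂ = pullFrac₂ eA.inv (ψ A₁ f₁)) {P₂ : S₂.FractionPair f₂ B₂}
    (R₂ : S₂.NthRoot f₂ P₂ N pullFrac₂) (hA₂ : S₂.IsGalois R₂.AN) (hB₂ : S₂.IsGalois R₂.BN)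
    (K₂ : S₂.BiKummerRoot R₂ hA₂ hB₂)
    (eAN : h.Ψ.functor.obj R₁.AN ≅ R₂.AN) (eB : h.Ψ.functor.obj R₁.BN ≅ R₂.BN)
    (_hnum : eAN.inv ≫ h.Ψ.functor.map R₁.pair.num ≫ eB.hom = R₂.pair.num)
    (_hden : ∃ u₀ : S₂.mu R₂.BN N,
      eAN.inv ≫ h.Ψ.functor.map R₁.pair.den ≫ eB.hom ≫ (u₀ : Aut R₂.BN).hom = R₂.pair.den)
    (ηA : S₁.HA R₁.AN hA₁ ≃* S₂.HA R₂.AN hA₂)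
    (_hηA : ∀ g : S₁.HA R₁.AN hA₁,
      ((ηA g : S₂.HA R₂.AN hA₂) : Aut R₂.AN) = eAN.symm ≪≫ h.Ψ.functor.mapIso ((g : Aut R₁.AN)) ≪≫ eAN)
    (η : S₁.HA R₁.BN hB₁ ≃* S₂.HA R₂.BN hB₂)
    (_hη : ∀ hh : S₁.HA R₁.BN hB₁,
      ((η hh : S₂.HA R₂.BN hB₂) : Aut R₂.BN) =
        eB.symm ≪≫ h.Ψ.functor.mapIso ((hh : Aut R₁.BN)) ≪≫ eB)
    (_hident : ∀ g : S₁.HA R₁.AN hA₁, K₂.ident (ηA g) = η (K₁.ident g))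
    (_hstriv : ∃ ζA : S₂.units R₂.AN, ∀ g : S₁.HA R₁.AN hA₁,
      K₂.striv (ηA g) = (ζA : Aut R₂.AN) * h.transportAut eAN (K₁.striv g) * (ζA : Aut R₂.AN)⁻¹),
    IsIsomorph A₁ S₁.Aodot → IsIsomorph A₂ S₂.Aodot →
      ∃ (ζ : S₂.units R₂.BN) (u : S₂.mu R₂.BN N), ∀ hh : S₁.HA R₁.BN hB₁,
        (eB.symm ≪≫ h.Ψ.functor.mapIso (K₁.sNum hh) ≪≫ eB) =
            (ζ : Aut R₂.BN) * K₂.sNum (η hh) * (ζ : Aut R₂.BN)⁻¹ ∧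
        (eB.symm ≪≫ h.Ψ.functor.mapIso (K₁.sDen hh) ≪≫ eB) =
            ((u : Aut R₂.BN) * (ζ : Aut R₂.BN)) * K₂.sDen (η hh) * ((u : Aut R₂.BN) * (ζ : Aut R₂.BN))⁻¹

end Theorem44

/-! ### Remark 4.4.1 (pp.95–96) — documentation
"one crucial difference between the bi-Kummer theory for tempered Frobenioids considered here and the
theory of [FrdII], §2, in the case of `p`-adic Frobenioids is that in the present case, there is no
reciprocity map. … These Kummer classes still depend on a crucial piece of Frobenioid-theoretic data —
namely, the cyclotome '`μ_N(-)`'. … This technical issue of 'rigidity of the Frobenioid-theoretic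
cyclotome' is … a central theme of bi-Kummer theory …". Commentary; no declaration. -/

end BiKummerSetting

end Literature.AnabelianGeometry.EtaleTheta
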